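import Literature.Probability.Percolation.ZdFourArmSepGlueOne
import Literature.Probability.Percolation.ZdFourArmBoundedRatio
import HarnessLib

/-!
# Quasi-multiplicativity of the four-arm probability on `ℤ²` from Kesten's separation theorem

Topic `Literature/Probability/Percolation`; critical bond percolation on `ℤ²`. PROOFS ONLY (no
definition, no named fact). This file closes the printed proof of
`DuminilCopinManolescuTassion2021_zdFourArm_quasiMult` (`ZdFourArmQuasiMult.lean`; DMT 2021,
Prop. 6.3: "the proof follows the same lines as for `q = 2`", i.e. Kesten 1987, Lemmas 4–6 and
(2.43); Nolin 2008, Thm. 11, Prop. 12, Prop. 17) MODULO its one external input, Kesten's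
arm-separation lower bound for the alternating four-arm event of bond percolation on `ℤ²`
(Kesten 1987, Lemmas 4–5; Nolin 2008, Thm. 11 with §8.1; DMT 2021, Prop. 6.2), which is not in
the tree and enters as the explicit hypothesis
`hsep : ∃ n₀ c, 0 < c ∧ ∀ n ≥ n₀, ∀ N ≥ 2n, c · P(fourArmTwoClusters n N) ≤ P(zdFourArmSep n N)`
of the final theorem (the event `zdFourArmSep` of `ZdFourArmSeparated.lean`).

* `zdFourArm_spaced_of_wellSeparated` — **well-spaced quasi-multiplicativity from separation**:
  with `A = 128 max(n₀, 2)`, for all `r ≥ 1`, `ρ ≥ A r`, `R ≥ A ρ`,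
  `c · P(F(r,ρ)) P(F(ρ,R)) ≤ P(F(r,R))` — separation at the scales `(n, ρ)` and `(4ρ, R)` with
  `n = 64 max(n₀, 2, r)`, then the gluing `real_fourArmTwoClusters_ge_of_sep` (`r ≥ 2`, corridors
  of height `r`, RSW at aspect ratio `A`) or `real_fourArmTwoClusters_one_ge_of_sep` (`r = 1`);
* `DuminilCopinManolescuTassion2021_zdFourArm_quasiMult_of_wellSeparated` — the fact from `hsep`
  (through `DuminilCopinManolescuTassion2021_zdFourArm_quasiMult_of_wellSpaced` of
  `ZdFourArmBoundedRatio.lean`: the normal form `zdFourArm_quasiMult_of_spaced` with its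
  bounded-ratio input proved from RSW), and with it `Nolin2008_zdEdgeFourArmQuasiMult`
  (`Nolin2008_zdEdgeFourArmQuasiMult_of_zdFourArm_wellSeparated`).

## References

* H. Kesten, *Scaling relations for 2D-percolation*, Comm. Math. Phys. 109 (1987), §2,
  Lemmas 4–6, (2.43) [KestenScalingCMP1987].
* P. Nolin, *Near-critical percolation in two dimensions*, EJP 13 (2008), §4.3 Thm. 11, Prop. 12,
  Lemma 13, §4.5 Prop. 17, §8.1 (arXiv 0711.4948: Thm. 10, Prop. 11, Lemma 12, Prop. 16) [Nolin2008].
* H. Duminil-Copin, I. Manolescu, V. Tassion, PTRF 181 (2021), §6.2 Prop. 6.2, Prop. 6.3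
  [DuminilCopinManolescuTassion2021].
-/

noncomputable section

open MeasureTheory Set

namespace Literature.Probability.Percolation

open LatticeModels SimpleGraph

/-! ### Well-spaced quasi-multiplicativity from the separation theorem -/

section Assembly

/-- **Well-spaced quasi-multiplicativity from arm separation** (Kesten 1987, Lemma 6 with
(2.43); Nolin 2008, Prop. 12 (ii) and Prop. 17): if, for `n ≥ n₀` and `N ≥ 2n`, the
well-separated four-arm event has probability comparable to the four-arm event,
`c · P(fourArmTwoClusters n N) ≤ P(zdFourArmSep n N)`, then with `A = 128 max(n₀, 2)` there is
`c' > 0` with `c' · P(F(r,ρ)) P(F(ρ,R)) ≤ P(F(r,R))` for all `r ≥ 1`, `ρ ≥ A r`, `R ≥ A ρ`.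
Proof: monotonicity `P(F(r,ρ)) ≤ P(F(n,ρ))`, `P(F(ρ,R)) ≤ P(F(4ρ,R))` with
`n = 64 max(n₀, 2, r)`; separation at the scales `(n, ρ)` and `(4ρ, R)`; the gluing
`real_fourArmTwoClusters_ge_of_sep` for `r ≥ 2` (corridors of height `r`, RSW at aspect ratio
`A`, `rsw_lowerBound_holds`) and `real_fourArmTwoClusters_one_ge_of_sep` for `r = 1`.
[cite: Nolin2008, §4.3 Prop. 12 (ii) and §4.5 Prop. 17 (arXiv 0711.4948: Prop. 11, Prop. 16)] [cite: KestenScalingCMP1987, §2 Lemma 6, (2.43)] [cite: DuminilCopinManolescuTassion2021, §6.2 Prop. 6.3 (arXiv 2007.14707 numbering)] -/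
theorem zdFourArm_spaced_of_wellSeparated
    (hsep : ∃ n₀ : ℕ, ∃ c : ℝ, 0 < c ∧ ∀ n N : ℕ, n₀ ≤ n → 2 * n ≤ N →
      c * (bondPercolation (zdGraph 2) half).real (fourArmTwoClusters n N) ≤
        (bondPercolation (zdGraph 2) half).real (zdFourArmSep n N)) :
    ∃ A : ℕ, 2 ≤ A ∧ ∃ c : ℝ, 0 < c ∧ ∀ r ρ R : ℕ, 1 ≤ r → A * r ≤ ρ → A * ρ ≤ R →
      c * ((bondPercolation (zdGraph 2) half).real (fourArmTwoClusters r ρ) *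
          (bondPercolation (zdGraph 2) half).real (fourArmTwoClusters ρ R)) ≤
        (bondPercolation (zdGraph 2) half).real (fourArmTwoClusters r R) := by
  obtain ⟨n₀, cs, hcs0, hs⟩ := hsep
  set P := bondPercolation (zdGraph 2) half with hP
  set n₁ : ℕ := max n₀ 2 with hn₁
  have hn₁2 : 2 ≤ n₁ := le_max_right _ _
  have hn₀1 : n₀ ≤ n₁ := le_max_left _ _
  set A : ℕ := 128 * n₁ with hA
  have hA256 : 256 ≤ A := by omega
  obtain ⟨ck, hck0, hck⟩ := rsw_lowerBound_holds A (by omega)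
  set h2 : ℝ := (1 / 2 : ℝ) ^ (2 + (box 2 2).sym2.card) with hh2
  have hh2pos : 0 < h2 := by positivity
  have hh2le : h2 ≤ 1 := pow_le_one₀ (by norm_num) (by norm_num)
  refine ⟨A, by omega, ck ^ 8 * h2 * cs ^ 2, by positivity, fun r ρ R hr hrρ hρR => ?_⟩
  -- scales
  set m : ℕ := max n₁ r with hm
  have hmr : r ≤ m := le_max_right _ _
  have hmn₁ : n₁ ≤ m := le_max_left _ _
  have hm_le : m ≤ n₁ * r := max_le (Nat.le_mul_of_pos_right n₁ hr) (Nat.le_mul_of_pos_left r (by omega))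
  set n : ℕ := 64 * m with hn
  have hAr : 2 * n ≤ A * r := by
    have : A * r = 128 * (n₁ * r) := by rw [hA, Nat.mul_assoc]
    omega
  have hA1 : A ≤ A * r := Nat.le_mul_of_pos_right A hr
  have hAρ : 256 * ρ ≤ A * ρ := Nat.mul_le_mul_right ρ hA256
  have h256 : 256 * (ρ / 64 + 1) ≤ A * (ρ / 64 + 1) := Nat.mul_le_mul_right _ hA256
  have hnρ : 2 * n ≤ ρ := hAr.trans hrρ
  have hn128 : 128 ≤ n := by omega
  have hn₀n : n₀ ≤ n := by omega
  have hρ2 : 2 ≤ ρ := by omega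
  -- separation at both scales, monotonicity
  have hs₁ : cs * P.real (fourArmTwoClusters n ρ) ≤ P.real (zdFourArmSep n ρ) := hs n ρ hn₀n hnρ
  have hs₂ : cs * P.real (fourArmTwoClusters (4 * ρ) R) ≤ P.real (zdFourArmSep (4 * ρ) R) :=
    hs (4 * ρ) R (by omega) (by omega)
  have hmono₁ : P.real (fourArmTwoClusters r ρ) ≤ P.real (fourArmTwoClusters n ρ) :=
    real_fourArmTwoClusters_mono half (by omega) (by omega) le_rfl
  have hmono₂ : P.real (fourArmTwoClusters ρ R) ≤ P.real (fourArmTwoClusters (4 * ρ) R) :=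
    real_fourArmTwoClusters_mono half (by omega) (by omega) le_rfl
  -- the gluing inequality
  have hglue : ck ^ 8 * h2 * (P.real (zdFourArmSep n ρ) * P.real (zdFourArmSep (4 * ρ) R)) ≤
      P.real (fourArmTwoClusters r R) := by
    rcases Nat.lt_or_ge r 2 with hr1 | hr2
    · obtain rfl : r = 1 := by omega
      have hmn : m = n₁ := by rw [hm]; exact max_eq_left (by omega)
      exact real_fourArmTwoClusters_one_ge_of_sep (n := n) (ρ := ρ) (ρ' := 4 * ρ) (R := R) (M₀ := n - 3)
        (K₀ := n - 4) (M₁ := 3 * ρ - 2) (K₁ := 3 * ρ - 4) (k := A) (by omega) (by omega) (by omega)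
        (by omega) hn128 hnρ (by omega) (by omega) (by omega) hck0 hck (by omega) (by omega) (by omega)
    · have hmul₀ : A * (r - 1 + 1) = A * r := by rw [Nat.sub_add_cancel hr]
      have hmul₁ : A * (r - 2 + 1) + A = A * r := by
        rw [← Nat.mul_succ]
        exact congrArg (A * ·) (by omega)
      have hAr2 : 2 * A ≤ A * r := (Nat.mul_comm 2 A).le.trans (Nat.mul_le_mul_left A hr2)
      have hX : 0 ≤ P.real (zdFourArmSep n ρ) * P.real (zdFourArmSep (4 * ρ) R) :=
        mul_nonneg measureReal_nonneg measureReal_nonneg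
      calc ck ^ 8 * h2 * (P.real (zdFourArmSep n ρ) * P.real (zdFourArmSep (4 * ρ) R))
          ≤ ck ^ 8 * 1 * (P.real (zdFourArmSep n ρ) * P.real (zdFourArmSep (4 * ρ) R)) :=
            mul_le_mul_of_nonneg_right (mul_le_mul_of_nonneg_left hh2le (by positivity)) hX
        _ = ck ^ 8 * (P.real (zdFourArmSep n ρ) * P.real (zdFourArmSep (4 * ρ) R)) := by ring
        _ ≤ P.real (fourArmTwoClusters r R) :=
          real_fourArmTwoClusters_ge_of_sep (r := r) (n := n) (ρ := ρ) (ρ' := 4 * ρ) (R := R) (M₀ := n - 1 - r)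
            (K₀ := n - 2 - r) (M₁ := 3 * ρ - 2) (K₁ := 3 * ρ - 4) (h₀ := r - 1) (h₁ := r - 2) (k := A)
            hr2 (by omega) (by omega) (by omega) (by omega) (by omega) (by omega) (by omega) (by omega)
            hn128 (by omega) hnρ (by omega) (by omega) (by omega) hck0 hck (by omega) (by omega)
            (by omega) (by omega)
  -- assembly
  calc ck ^ 8 * h2 * cs ^ 2 * (P.real (fourArmTwoClusters r ρ) * P.real (fourArmTwoClusters ρ R))
      = ck ^ 8 * h2 * ((cs * P.real (fourArmTwoClusters r ρ)) * (cs * P.real (fourArmTwoClusters ρ R))) := by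
        ring
    _ ≤ ck ^ 8 * h2 * ((cs * P.real (fourArmTwoClusters n ρ)) * (cs * P.real (fourArmTwoClusters (4 * ρ) R))) :=
        mul_le_mul_of_nonneg_left (mul_le_mul (mul_le_mul_of_nonneg_left hmono₁ hcs0.le)
          (mul_le_mul_of_nonneg_left hmono₂ hcs0.le) (mul_nonneg hcs0.le measureReal_nonneg)
          (mul_nonneg hcs0.le measureReal_nonneg)) (by positivity)
    _ ≤ ck ^ 8 * h2 * (P.real (zdFourArmSep n ρ) * P.real (zdFourArmSep (4 * ρ) R)) :=
        mul_le_mul_of_nonneg_left (mul_le_mul hs₁ hs₂ (mul_nonneg hcs0.le measureReal_nonneg) measureReal_nonneg)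
          (by positivity)
    _ ≤ P.real (fourArmTwoClusters r R) := hglue

/-- **Quasi-multiplicativity of the alternating four-arm probability on `ℤ²` from Kesten's
separation theorem.** The fact `DuminilCopinManolescuTassion2021_zdFourArm_quasiMult` (DMT 2021,
Prop. 6.3, upper inequality, `q = 1`, `σ = 1010`) follows from the well-separation lower bound
`c · P(fourArmTwoClusters n N) ≤ P(zdFourArmSep n N)` (`n ≥ n₀`, `N ≥ 2n`; Kesten 1987,
Lemmas 4–5; Nolin 2008, Thm. 11 and §8.1; DMT 2021, Prop. 6.2 — the hypothesis `hsep`, not yet in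
the tree): the normal form `zdFourArm_quasiMult_of_spaced` with the well-spaced inequality
`zdFourArm_spaced_of_wellSeparated` and the bounded-ratio positivity
`exists_pos_le_real_fourArmTwoClusters_of_ratio` of `ZdFourArmBoundedRatio.lean` (RSW). [cite: DuminilCopinManolescuTassion2021, §6.2 Prop. 6.2 and Prop. 6.3 (arXiv 2007.14707 numbering)] [cite: Nolin2008, §4.3 Thm. 11, Prop. 12, §4.5 Prop. 17 (arXiv 0711.4948: Thm. 10, Prop. 11, Prop. 16)] [cite: KestenScalingCMP1987, §2 Lemmas 4–6, (2.43)] -/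
theorem DuminilCopinManolescuTassion2021_zdFourArm_quasiMult_of_wellSeparated
    (hsep : ∃ n₀ : ℕ, ∃ c : ℝ, 0 < c ∧ ∀ n N : ℕ, n₀ ≤ n → 2 * n ≤ N →
      c * (bondPercolation (zdGraph 2) half).real (fourArmTwoClusters n N) ≤
        (bondPercolation (zdGraph 2) half).real (zdFourArmSep n N)) :
    DuminilCopinManolescuTassion2021_zdFourArm_quasiMult := by
  obtain ⟨A, hA, hsp⟩ := zdFourArm_spaced_of_wellSeparated hsep
  exact DuminilCopinManolescuTassion2021_zdFourArm_quasiMult_of_wellSpaced hA hsp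

/-- **The single-bond quasi-multiplicativity `Nolin2008_zdEdgeFourArmQuasiMult` from Kesten's
separation theorem** (through `Nolin2008_zdEdgeFourArmQuasiMult_of_wellSpaced` of
`ZdFourArmBoundedRatio.lean`). [cite: Nolin2008, §4.1 and §4.5 Prop. 17 (arXiv 0711.4948: Prop. 16)] -/
theorem Nolin2008_zdEdgeFourArmQuasiMult_of_zdFourArm_wellSeparated
    (hsep : ∃ n₀ : ℕ, ∃ c : ℝ, 0 < c ∧ ∀ n N : ℕ, n₀ ≤ n → 2 * n ≤ N →
      c * (bondPercolation (zdGraph 2) half).real (fourArmTwoClusters n N) ≤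
        (bondPercolation (zdGraph 2) half).real (zdFourArmSep n N)) :
    Nolin2008_zdEdgeFourArmQuasiMult := by
  obtain ⟨A, hA, hsp⟩ := zdFourArm_spaced_of_wellSeparated hsep
  exact Nolin2008_zdEdgeFourArmQuasiMult_of_wellSpaced hA hsp

end Assembly

end Literature.Probability.Percolation

end
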